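import Mathlib.Analysis.Distribution.Support
import Mathlib.Analysis.Distribution.SchwartzSpace.Basic
import Mathlib.Geometry.Manifold.PartitionOfUnity
import Mathlib.Topology.MetricSpace.Thickening
import Literature.MathematicalPhysics.QuantumLattice.SchwartzTranslationCutoff
import HarnessLib

/-!
# Local vanishing of tempered distributions: compact reduction and gluing

Topic `Literature/Analysis/FunctionSpaces` (support file for the spectral condition (b) of the
Wightman distributions, `Literature.MathematicalPhysics.QuantumLattice.IsWightmanQFT.hasSpectralCondition_family` of
`WightmanFunctionsFamilyProofs`, Streater–Wightman (1964), §3-3, Thm. 3-2 (b)).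

For a tempered distribution `T : 𝓢(E, ℂ) →L[ℂ] ℂ` on a finite-dimensional real normed space
`E`, Mathlib's `Distribution.IsVanishingOn T U` says `T G = 0` whenever `supp G ⊆ U`
(Hörmander I, Def. 2.2.2: the restriction of `T` to the open set `U` vanishes). This file proves
the two elementary facts about this notion that the spectral condition needs:

* `isVanishingOn_of_isVanishingOnCompact` — it suffices to test *compactly supported* `G`
  (compactly supported Schwartz functions are dense with control of supports,
  `Literature.MathematicalPhysics.QuantumLattice.exists_tsupport_subset_inter_closedBall_tendsto`; Hörmander I, Lemma 7.1.8 /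
  Thm. 2.2.1);
* `isVanishingOnCompact_iUnion`, `isVanishingOn_iUnion` — **gluing**: if `T` vanishes on each
  open `Uᵢ` of a finite family, it vanishes on `⋃ᵢ Uᵢ` (smooth partition of unity on `supp G`
  subordinate to `(Uᵢ)`, `SmoothPartitionOfUnity.exists_isSubordinate`, times a compactly
  supported cutoff so that the pieces are Schwartz; Hörmander I, Thm. 2.2.1: "if every point of
  `X` has a neighbourhood on which `u = 0` then `u = 0`");
* `isVanishingOnCompact_preimage` — a criterion for vanishing on a preimage `f ⁻¹' W` under a
  linear map: it suffices that `T((θ ∘ f) G) = 0` for all smooth compactly supported `θ` with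
  `supp θ ⊆ W` (the form in which a spectral condition on a *partial momentum* `f(p)` arrives),
  via a smooth Urysohn cutoff `θ = 1` on `f(supp G)` (`exists_smooth_one_of_isCompact_subset_isOpen`,
  from `exists_contMDiffMap_one_nhds_of_subset_interior`).

## References

* L. Hörmander, *The Analysis of Linear Partial Differential Operators I* (1983; 2nd ed. 1990), §1.4 (Thm. 1.4.1, cutoff functions), §2.2
  (Def. 2.2.2, Thm. 2.2.1: localization, `supp u`), Lemma 7.1.8. [HormanderALPDO1]
* R. F. Streater, A. S. Wightman, *PCT, Spin and Statistics, and All That* (1964), §2-1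
  (support of a distribution), §3-3 Thm. 3-2 (b). [StreaterWightman1964]

## Mathlib

`Distribution.IsVanishingOn`, `SmoothPartitionOfUnity.exists_isSubordinate`,
`SmoothPartitionOfUnity.sum_eq_one`, `exists_contMDiffMap_one_nhds_of_subset_interior`,
`IsCompact.exists_cthickening_subset_open`, `HasCompactSupport.hasTemperateGrowth`,
`SchwartzMap.smulLeftCLM`; tree: `Literature.MathematicalPhysics.QuantumLattice.exists_tsupport_subset_inter_closedBall_tendsto`
(`SchwartzTranslationCutoff`). Mathlib's `Distribution.IsVanishingOn` API (`Support.lean`) has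
monotonicity and `dsupport` but, at the pin, no gluing over unions for Schwartz test functions.
-/

noncomputable section

open Filter Topology Set
open scoped SchwartzMap Manifold ContDiff

namespace Literature.Analysis.FunctionSpaces

namespace SchwartzSupport

variable {E : Type*} [NormedAddCommGroup E] [NormedSpace ℝ E] [FiniteDimensional ℝ E]

/-- **Smooth compactly supported cutoff equal to `1` on a compact set inside an open set**
(smooth Urysohn lemma: `K ⊆ U`, `K` compact, `U` open, gives `θ ∈ C_c^∞`, `0 ≤ θ ≤ 1`,
`θ = 1` on `K`, `supp θ ⊆ U`; Hörmander I, Thm. 1.4.1). [cite: HormanderALPDO1, Thm. 1.4.1] -/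
theorem exists_smooth_one_of_isCompact_subset_isOpen {K U : Set E} (hK : IsCompact K)
    (hU : IsOpen U) (hKU : K ⊆ U) :
    ∃ θ : E → ℝ, ContDiff ℝ ∞ θ ∧ HasCompactSupport θ ∧ tsupport θ ⊆ U ∧ (∀ x ∈ K, θ x = 1) ∧
      ∀ x, θ x ∈ Icc (0 : ℝ) 1 := by
  -- a compact closed neighbourhood `cthickening δ K ⊆ U`
  obtain ⟨δ, hδ, hδU⟩ := hK.exists_cthickening_subset_open hU hKU
  have hKc : IsCompact (Metric.cthickening δ K) := hK.cthickening
  have hint : K ⊆ interior (Metric.cthickening δ K) :=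
    (Metric.self_subset_thickening hδ K |>.trans (Metric.thickening_subset_interior_cthickening δ K))
  obtain ⟨f, h1, h0, h01⟩ := exists_contMDiffMap_one_nhds_of_subset_interior 𝓘(ℝ, E)
    (n := (⊤ : ℕ∞)) hK.isClosed hint
  refine ⟨f, ?_, ?_, ?_, fun x hx => ?_, h01⟩
  · exact f.contMDiff.contDiff
  · refine HasCompactSupport.of_support_subset_isCompact hKc fun x hx => ?_
    by_contra hx'
    exact hx (h0 x hx')
  · refine (closure_minimal (fun x hx => ?_) hKc.isClosed).trans hδU
    by_contra hx'
    exact hx (h0 x hx')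
  · exact h1.self_of_nhdsSet x hx

variable (T : 𝓢(E, ℂ) →L[ℂ] ℂ)

/-- `T` **vanishes on compactly supported test functions inside `U`**: `T G = 0` whenever
`supp G` is compact and contained in `U` (the compactly supported version of Mathlib's
`Distribution.IsVanishingOn`; Hörmander I, Def. 2.2.2 with `C_c^∞` test functions). [cite: HormanderALPDO1, Def. 2.2.2] -/
def IsVanishingOnCompact (U : Set E) : Prop :=
  ∀ G : 𝓢(E, ℂ), HasCompactSupport (G : E → ℂ) → tsupport (G : E → ℂ) ⊆ U → T G = 0

omit [FiniteDimensional ℝ E] in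
/-- `IsVanishingOnCompact` is monotone in the set. [folklore] -/
theorem IsVanishingOnCompact.mono {T : 𝓢(E, ℂ) →L[ℂ] ℂ} {U U' : Set E}
    (h : IsVanishingOnCompact T U) (hU : U' ⊆ U) : IsVanishingOnCompact T U' :=
  fun G hc hG => h G hc (hG.trans hU)

/-- **Compact reduction**: vanishing on compactly supported test functions inside `U` implies
vanishing on all Schwartz test functions supported in `U` (approximate `G` in `𝒮` by cutoffs
`χ(x/R) G` supported in `supp G ∩ B̄(0, 2R)` and use the continuity of `T`; Hörmander I,
Lemma 7.1.8 and Thm. 2.2.1). [cite: HormanderALPDO1, Lemma 7.1.8] -/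
theorem isVanishingOn_of_isVanishingOnCompact {U : Set E} (h : IsVanishingOnCompact T U) :
    Distribution.IsVanishingOn (T : 𝓢(E, ℂ) → ℂ) U := by
  intro G hG
  obtain ⟨g, hg, hlim⟩ := Literature.MathematicalPhysics.QuantumLattice.exists_tsupport_subset_inter_closedBall_tendsto G
  have h0 : ∀ m, T (g m) = 0 := fun m =>
    h (g m) (IsCompact.of_isClosed_subset (isCompact_closedBall _ _) (isClosed_tsupport _)
      ((hg m).trans inter_subset_right)) (((hg m).trans inter_subset_left).trans hG)
  have hT := (T.continuous.tendsto G).comp hlim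
  have : (fun m => T (g m)) = fun _ => 0 := funext h0
  rw [Function.comp_def, this] at hT
  exact tendsto_nhds_unique hT tendsto_const_nhds

omit [FiniteDimensional ℝ E] in
/-- Multiplication of a Schwartz function by a smooth compactly supported function, pointwise
(`SchwartzMap.smulLeftCLM` with `HasCompactSupport.hasTemperateGrowth`). [folklore] -/
theorem smulLeftCLM_apply_of_hasCompactSupport {θ : E → ℂ} (hθ : ContDiff ℝ ∞ θ)
    (hc : HasCompactSupport θ) (G : 𝓢(E, ℂ)) (x : E) :
    SchwartzMap.smulLeftCLM ℂ θ G x = θ x * G x := by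
  rw [SchwartzMap.smulLeftCLM_apply_apply (hc.hasTemperateGrowth hθ), smul_eq_mul]

/-- **Gluing over a finite open cover**, compactly supported test functions: if `T` vanishes on
compactly supported test functions inside each open `Uᵢ`, then inside `⋃ᵢ Uᵢ`. Proof: write
`G = ∑ᵢ (θρᵢ) G` with `(ρᵢ)` a smooth partition of unity on `supp G` subordinate to `(Uᵢ)` and `θ`
a compactly supported smooth cutoff equal to `1` on `supp G`; each piece is a Schwartz function
with compact support in `Uᵢ` (Hörmander I, Thm. 2.2.1). [cite: HormanderALPDO1, Thm. 2.2.1] -/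
theorem isVanishingOnCompact_iUnion {ι : Type*} [Fintype ι] {U : ι → Set E}
    (hU : ∀ i, IsOpen (U i)) (h : ∀ i, IsVanishingOnCompact T (U i)) :
    IsVanishingOnCompact T (⋃ i, U i) := by
  intro G hGc hGU
  -- smooth partition of unity on `tsupport G` subordinate to `U`
  obtain ⟨ρ, hρ⟩ :=
    SmoothPartitionOfUnity.exists_isSubordinate 𝓘(ℝ, E) (isClosed_tsupport _) U hU hGU
  -- a compactly supported smooth cutoff equal to one on `tsupport G`
  obtain ⟨θ, hθs, hθc, -, hθ1, -⟩ :=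
    exists_smooth_one_of_isCompact_subset_isOpen hGc isOpen_univ (subset_univ _)
  -- the pieces
  let χ : ι → E → ℂ := fun i x => ((θ x * ρ i x : ℝ) : ℂ)
  have hχs : ∀ i, ContDiff ℝ ∞ (χ i) := fun i =>
    (Complex.ofRealCLM.contDiff.comp (hθs.mul ((ρ i).contMDiff.contDiff)))
  have hχc : ∀ i, HasCompactSupport (χ i) := fun i =>
    (hθc.mul_right (f' := fun x => ρ i x)).comp_left (g := fun r : ℝ => (r : ℂ)) Complex.ofReal_zero
  have hχU : ∀ i, tsupport (χ i) ⊆ U i := fun i =>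
    (tsupport_comp_subset Complex.ofReal_zero _).trans ((tsupport_mul_subset_right).trans (hρ i))
  let Gi : ι → 𝓢(E, ℂ) := fun i => SchwartzMap.smulLeftCLM ℂ (χ i) G
  have hcoe : ∀ i, (Gi i : E → ℂ) = fun x => χ i x * G x := fun i =>
    funext fun x => smulLeftCLM_apply_of_hasCompactSupport (hχs i) (hχc i) G x
  have hGi : ∀ i, T (Gi i) = 0 := fun i => by
    refine h i (Gi i) ?_ ?_
    · rw [hcoe]; exact (hχc i).mul_right
    · rw [hcoe]; exact (tsupport_mul_subset_left).trans (hχU i)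
  have hsum : G = ∑ i, Gi i := by
    ext x
    have hx' : (∑ i, Gi i) x = ∑ i, χ i x * G x := by
      rw [show ((∑ i, Gi i : 𝓢(E, ℂ)) : E → ℂ) x = ∑ i, (Gi i : E → ℂ) x from sum_apply _ _ _]
      exact Finset.sum_congr rfl fun i _ => by rw [hcoe]
    rw [hx', ← Finset.sum_mul]
    by_cases hx : x ∈ tsupport (G : E → ℂ)
    · have : ∑ i, χ i x = 1 := by
        simp only [χ, ← Complex.ofReal_sum, hθ1 x hx, one_mul]
        rw [← finsum_eq_sum_of_fintype, ρ.sum_eq_one hx, Complex.ofReal_one]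
      rw [this, one_mul]
    · rw [image_eq_zero_of_notMem_tsupport hx, mul_zero]
  rw [hsum, map_sum]
  exact Finset.sum_eq_zero fun i _ => hGi i

/-- **Gluing over a finite open cover**: if `T` vanishes on compactly supported test functions
inside each open `Uᵢ`, then `T` vanishes (on all Schwartz test functions supported) in `⋃ᵢ Uᵢ`
(Hörmander I, Thm. 2.2.1, for tempered distributions and Schwartz test functions). [cite: HormanderALPDO1, Thm. 2.2.1] -/
theorem isVanishingOn_iUnion {ι : Type*} [Fintype ι] {U : ι → Set E} (hU : ∀ i, IsOpen (U i))
    (h : ∀ i, IsVanishingOnCompact T (U i)) :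
    Distribution.IsVanishingOn (T : 𝓢(E, ℂ) → ℂ) (⋃ i, U i) :=
  isVanishingOn_of_isVanishingOnCompact T (isVanishingOnCompact_iUnion T hU h)

variable {P : Type*} [NormedAddCommGroup P] [NormedSpace ℝ P] [FiniteDimensional ℝ P]

omit [FiniteDimensional ℝ E] in
/-- **Compact vanishing on a preimage from vanishing of cut-off test functions.** Let
`f : E →L[ℝ] P` and `W ⊆ P` open. If `T((θ ∘ f) · G) = 0` for every smooth compactly supported
`θ : P → ℝ` with `supp θ ⊆ W` and every `G`, then `T` vanishes on compactly supported test
functions inside `f ⁻¹' W`: choose `θ = 1` on the compact set `f(supp G) ⊆ W`, so that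
`(θ ∘ f) · G = G`. [folklore] -/
theorem isVanishingOnCompact_preimage (f : E →L[ℝ] P) {W : Set P} (hW : IsOpen W)
    (h : ∀ θ : P → ℝ, ContDiff ℝ ∞ θ → HasCompactSupport θ → tsupport θ ⊆ W →
      ∀ G : 𝓢(E, ℂ), T (SchwartzMap.smulLeftCLM ℂ (fun x => ((θ (f x) : ℝ) : ℂ)) G) = 0) :
    IsVanishingOnCompact T (f ⁻¹' W) := by
  intro G hGc hGW
  have hK : IsCompact (f '' tsupport (G : E → ℂ)) := hGc.image f.continuous
  obtain ⟨θ, hθs, hθc, hθW, hθ1, -⟩ := exists_smooth_one_of_isCompact_subset_isOpen hK hW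
    (image_subset_iff.2 hGW)
  have hg : (fun x => ((θ (f x) : ℝ) : ℂ)).HasTemperateGrowth :=
    (Complex.ofRealCLM.hasTemperateGrowth.comp (hθc.hasTemperateGrowth hθs)).comp
      f.hasTemperateGrowth
  have heq : SchwartzMap.smulLeftCLM ℂ (fun x => ((θ (f x) : ℝ) : ℂ)) G = G := by
    ext x
    rw [SchwartzMap.smulLeftCLM_apply_apply hg, smul_eq_mul]
    by_cases hx : x ∈ tsupport (G : E → ℂ)
    · rw [hθ1 (f x) (mem_image_of_mem f hx), Complex.ofReal_one, one_mul]
    · rw [image_eq_zero_of_notMem_tsupport hx, mul_zero]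
  rw [← heq]
  exact h θ hθs hθc hθW G

end SchwartzSupport

end Literature.Analysis.FunctionSpaces
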